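import Summits.QuantumFields.YangMills.Theorems.BalabanUVNodesN19TVKernelChain
import Literature.MathematicalPhysics.QuantumFieldTheory.Balaban1983to89.T4CauchySum

/-!
# BalabanUVNodes ∕ N19 — THE TV CURRENCY's COMMON-STEP CONTRACTION (DOBRUSHIN's ROW COEFFICIENT), KERNEL LEVEL: a Markov step COMMON to both runs whose
# rows are pairwise `α`-close shrinks the runs' set-closeness radius by `α` (SHARP); Doeblin ⇒ `α ≤ 1 − β`; coefficients MULTIPLY under composition (so
# finite-range steps contract once their composite has overlapping rows); along a chain the radius is node U4's transported total `T4CauchySum.delta 1 a inj`;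
# and with MASS_cl the summable TV_cl radius gives the N19′ shape `∃ δ, Spine.NE7.Core … δ ∧ Summable δ` (dag-n19-c's `core_of_mass_of_tv` BY NAME)

Cell `pub-ymgap` (HUMAN RULING D-0062 Track A ∕ D-0149 width seats), WIDTH SEAT `pub-ymgap-dag-n19-w2` (node n19 = NE7, seat 2 of 3), generation g8,
CLAIM-1 ∕ INTENT-1 (INBOX l.38561).  Route `Summits/QuantumFields/YangMills/Theses/BalabanUVNodes.lean`, key item K3⁸ `SpineGivenEndpointR13SepCoPHV`
(stmt-QuantumFields-27366; predecessor K3⁷ 20544 aside); filed `--kind proof --supports … --as helper`.  COUNT-NEUTRAL.  THEOREMS ONLY (0 `def`, 0 `sorry`);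
imports this seat's g4 `…N19TVKernelChain` (p607251: `comp_real_eq_integral`, `measurable_kernelReal`, the data-processing step `abs_comp_real_sub_comp_real_le_base`,
and through it g4 file 1 `…N19TVProductBlocks` — `radius_nonneg_of_tv`, `abs_real_sub_real_le_one`, `integrable_of_unit_range` —, dag-n19-c's `…N19TVCurrency`
(`abs_integral_sub_integral_le_of_tv`) and `…N19CoreTVInvariant` (`core_of_mass_of_tv`), g4 file 2's `twoPoint_toy`) and the tree's `…Balaban1983to89.T4CauchySum`
(`delta`, `InjectedRate`, `summable_delta`) — all CONSUMED BY NAME; edits nothing, re-declares nothing.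

WHY (the one composition rule g4 left at factor ONE).  In the TV_cl currency of dag-n19-c (two laws `ρ`-close on every measurable SET) g4 typed products, disintegrations
and chains, and recorded that a Markov step COMMON to both runs is FREE — data processing, `abs_comp_real_sub_comp_real_le_base`, factor `1`, «no transport factor in
this currency».  The factor is in fact DOBRUSHIN's ROW COEFFICIENT of the common step: if the step's rows `κ_x`, `κ_y` are pairwise `α`-close on every set, two
`ρ₁`-close inputs come out `α·ρ₁`-close (§1, SHARP §5).  This is the TV twin of g6's Birkhoff ∕ Hopf files (`…N19BirkhoffContraction`, `…N19CoreCommonStep`: a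
common POSITIVE step contracts the class-oscillation half of `Core` by `tanh(Δ∕4)`, `Δ` the projective diameter), with the hypothesis that local renormalisation
steps can meet: a FINITE-RANGE kernel has disjoint rows (`α = 1`, infinite projective diameter — g6's located caveat), but coefficients MULTIPLY under composition
(§3), so as soon as an `m`-fold composite has overlapping rows (a DOEBLIN minorisation `β·ν ≤ κ_x`, §2: `α ≤ 1 − β`) every further block of `m` common steps
contracts.  Along a chain with per-step fibre injections `σ_k` the radius after `n` steps is `Σ_{j+m=n} s_j·a^m` (`s₀ = ρ₀`, `s_{k+1} = σ_k`; §4) — LITERALLY node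
U4's transported total `T4CauchySum.delta 1 a (fun _ ↦ s) n`, with the contraction `a` PRODUCED by the common steps' coefficients instead of postulated; exactly
common steps forget the birth discrepancy geometrically (`≤ ρ₀·aⁿ`, vs g4's `_le_initial` `≤ ρ₀`).  §6 closes the loop to node U5: dag-n19-c's necessary-and-
sufficient invariant MASS_cl ∧ TV_cl ⇒ `Spine.NE7.Core` (`core_of_mass_of_tv`) with a TV_cl radius dominated by `delta E a inj` under `InjectedRate C c θ inj`,
`a, θ ∈ [0,1[`, and a summable MASS radius gives the N19′ SHAPE `∃ δ, Core … δ ∧ Summable δ` — the TV twin of g6-S's `coreEdge_of_totals_of_commonSteps` with NO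
projective-diameter hypothesis.

PRIOR ART, CITED BY NAME, NOT RESTATED.  The FINITE-STATE theory (stochastic matrices, row vectors, `ℓ¹`) is the tree's `Literature.Probability.MarkovChains.
ErgodicityCoefficient` (cell pub-lqcd: `ergodicCoeff`, `tvDist_stepLaw_le_mul` = Dobrushin's contraction, `ergodicCoeff_le_one_sub_of_minorised` = Doeblin ⇒ Dobrushin;
[KirklandNeumann2012] §5.3, [FasinoTudisco2020] §4.1) and `…ErgodicityCoefficientProducts` (`ergodicCoeff_mul_le`, [DelMoral2004] Prop. 4.2.1); Harris' theorem in
FUNCTION form is `Literature.Probability.Process.HarrisTheorem` (Hairer–Mattingly 2011; its header: «the dual (measure) formulation … is not formalised»).  THIS FILE is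
the measure ∕ Mathlib-`Kernel` edition in dag-n19-c's set-closeness letters (`|p′.real S − p.real S| ≤ ρ`, `κ ∘ₘ p`), which none of those carries, plus the N19 hook.

WHAT IS PROVED ([folklore] measure theory; kernels are Mathlib `ProbabilityTheory.Kernel`, Markov; «rows `α`-close» = `∀ x y S, |κ_x(S) − κ_y(S)| ≤ α`).
* §0 `exists_bounds_of_rows` — a `[0,1]`-valued function on a nonempty type with pairwise `α`-close values has global bounds `m ≤ f ≤ M`, `M − m ≤ α` (`⨅`∕`⨆`).
* §1 ★★ `abs_comp_real_sub_comp_real_le_mul_of_tv` (DOBRUSHIN, kernel level): base laws `ρ₁`-close + ONE common Markov kernel with rows `α`-close ⇒ images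
  `α·ρ₁`-close (§0 on the fibre function `x ↦ κ_x(S)`, then dag-n19-c's `abs_integral_sub_integral_le_of_tv`) · `rows_le_one` (rows are always `1`-close: g4's data
  processing is the case `α = 1`) · ★ `abs_comp_real_sub_comp_real_le_mul_add_of_tv` (run B's kernel fibrewise `ρ₂`-close to run A's, run A's with row coefficient `α`
  ⇒ `α·ρ₁ + ρ₂`) · `abs_comp_comp_real_sub_le_mul_mul_of_tv` (two common steps: `α₂·α₁·ρ₁`).
* §2 ★ `rows_le_one_sub_of_minorised` (DOEBLIN ⇒ DOBRUSHIN): `β·ν(S) ≤ κ_x(S)` on every set for all `x`, `ν` a probability law, `β ≤ 1` ⇒ rows `(1 − β)`-close.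
* §3 ★★ `rows_comp_le_mul` (SUBMULTIPLICATIVITY): rows of `κ₁` `α₁`-close, rows of `κ₂` `α₂`-close ⇒ rows of `κ₂ ∘ₖ κ₁` `α₂·α₁`-close (`Kernel.comp_apply` + §1).
* §4 ★★ `abs_chain_real_sub_le_antidiagonal` (g4 §3's chains `μ_{k+1} = κ_k ∘ₘ μ_k`, `μ′_{k+1} = κ′_k ∘ₘ μ′_k`, recursion as HYPOTHESES; run A's steps with row
  coefficient `a ≥ 0`, run B's steps fibrewise `s (k+1)`-close to run A's, birth radius `s 0`) ⇒ at step `n` the laws are `(Σ_{(j,m) ∈ antidiagonal n} s_j·a^m)`-close ·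
  ★ `abs_chain_real_sub_le_delta` (the same, `= T4CauchySum.delta 1 a (fun _ ↦ s) n`) · ★ `abs_chain_real_sub_le_mul_pow_of_common` (exactly common steps: `≤ s₀·aⁿ`).
* §5 ★ `tv_commonStep_sharp_toy` (Bool; base `δ_false` vs `(1−ρ₁)δ_false + ρ₁δ_true`, ONE kernel `false ↦ δ_false`, `true ↦ (1−α)δ_false + αδ_true`: Markov, rows
  `α`-close, image gap at `{true}` EQUALS `α·ρ₁` — §1's constant is optimal).
* §6 ★★ `coreEdge_of_mass_of_tv_delta` — dag-n19-c's `core_of_mass_of_tv` BY NAME with `ρ K ≤ delta E a inj K`, `InjectedRate C c θ inj`, `0 ≤ E`, `a, θ ∈ [0,1[`,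
  `0 ≤ l₀`, `0 < vol`, `Summable r₁` ⇒ `∃ δ, Spine.NE7.Core l₀ vol T Bad P Q δ ∧ Summable δ`.  (Per `(K, τ)` the bound `ρ K ≤ delta …` is §4 read on a chain
  representation of the two runs' normalised class laws — a HYPOTHESIS SHAPE; composing §4 with §6 is one `le_trans` per class and is left to the consumer who names
  such a representation.)

HONEST FRAMING.  [folklore] measure theory (Dobrushin 1956 ∕ Doeblin 1937; printed finite ∕ abstract forms as cited above) on hypothesis SHAPES produced by nobody:
NO R ∕ T step of [Balaban1988Convergent] ∕ [Balaban1989LargeFieldI] ∕ [Balaban1989LargeFieldII] is shown here (or anywhere in the tree) to act on the two runs'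
class laws as a COMMON Markov kernel with row coefficient `< 1` (the runs' steps are displayed as `IsRT` ∕ integral-preserving maps on densities, `T4Continuum.Realisation`;
the LENS control census, INBOX l.16691, lists «Dobrushin» among mechanisms with no Bałaban instance); like dag-n19-c's TV_cl this is a PER-CLASS tool (the global total
variation of two lattice Gibbs laws degenerates with the volume).  ZERO Bałaban content; NE7 ∕ NE1′ NOT PRINTED as two-run statements for d = 4 and NOT proved; N14 ∕ N19
NOT discharged; K3⁸ 27366 OPEN, not claimed; counts UNMOVED (typed 28∕28 · discharged 5∕27, A 5∕28); no count claim.  One finite four-torus programme at fixed `ε`;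
R4 closes the conditional finite-𝕋⁴ rung `BalabanLadder.UV` only — NOT ℝ⁴, NOT OS, NOT the Yang–Mills mass gap, NOT Clay.  0 `def`; 0 `sorry`; standard axioms.
-/

set_option autoImplicit false

noncomputable section

open MeasureTheory ProbabilityTheory Finset
open scoped ENNReal

namespace Summit.QuantumFields.YangMills.BalabanUVNodes.N19TVCommonStepContraction

open Summit.QuantumFields.YangMills.BalabanUVNodes.N19TVCurrency (abs_integral_sub_integral_le_of_tv)
open Summit.QuantumFields.YangMills.BalabanUVNodes.N19TVProductBlocks (radius_nonneg_of_tv abs_real_sub_real_le_one integrable_of_unit_range)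
open Summit.QuantumFields.YangMills.BalabanUVNodes.N19CoreTVInvariantBlocks (twoPoint_toy)
open Summit.QuantumFields.YangMills.BalabanUVNodes.N19TVKernelChain (measurable_kernelReal comp_real_eq_integral
  abs_comp_real_sub_comp_real_le_add_of_tv)
open Literature.MathematicalPhysics.QuantumFieldTheory.Balaban1983to89.T4CauchySum (delta InjectedRate summable_delta delta_nonneg)

/-! ## §0 Pairwise closeness of a bounded function gives global bounds of width `α` [folklore] -/

section Bounds

variable {X : Type*}

/-- A function with values in `[0, 1]` on a NONEMPTY type whose values are pairwise `α`-close has global bounds `m ≤ f ≤ M` with `m ≤ M` and `M − m ≤ α`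
(`m = ⨅ f`, `M = ⨆ f`). [folklore] -/
theorem exists_bounds_of_rows [Nonempty X] {f : X → ℝ} {α : ℝ} (h0 : ∀ x, 0 ≤ f x) (h1 : ∀ x, f x ≤ 1)
    (hα : ∀ x y, f x - f y ≤ α) : ∃ m M : ℝ, (∀ x, m ≤ f x) ∧ (∀ x, f x ≤ M) ∧ m ≤ M ∧ M - m ≤ α := by
  have hbb : BddBelow (Set.range f) := ⟨0, by rintro _ ⟨x, rfl⟩; exact h0 x⟩
  have hba : BddAbove (Set.range f) := ⟨1, by rintro _ ⟨x, rfl⟩; exact h1 x⟩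
  obtain ⟨x₀⟩ := ‹Nonempty X›
  refine ⟨⨅ x, f x, ⨆ x, f x, fun x => ciInf_le hbb x, fun x => le_ciSup hba x, (ciInf_le hbb x₀).trans (le_ciSup hba x₀), ?_⟩
  have hM : (⨆ x, f x) ≤ (⨅ y, f y) + α := ciSup_le fun x => by
    have : f x - α ≤ ⨅ y, f y := le_ciInf fun y => by linarith [hα x y]
    linarith
  linarith

end Bounds

/-! ## §1 One COMMON Markov step contracts by its row coefficient (Dobrushin) [folklore] -/

section Step

variable {X Y Z : Type*} [MeasurableSpace X] [MeasurableSpace Y] [MeasurableSpace Z]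
  {p p' : Measure X} [IsProbabilityMeasure p] [IsProbabilityMeasure p'] {κ κ' : Kernel X Y} [IsMarkovKernel κ] [IsMarkovKernel κ']
  {α ρ₁ ρ₂ : ℝ}

/-- The rows of a Markov kernel are `1`-close on every set for free — so a row coefficient may always be capped at `1`, and g4's data-processing step
`N19TVKernelChain.abs_comp_real_sub_comp_real_le_base` is the case `α = 1` of the next theorem. [folklore] -/
theorem rows_le_one (κ : Kernel X Y) [IsMarkovKernel κ] (x y : X) (S : Set Y) : |(κ x).real S - (κ y).real S| ≤ 1 :=
  abs_real_sub_real_le_one (κ y) (κ x) S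

/-- ★★ **DOBRUSHIN's CONTRACTION, KERNEL LEVEL.**  Base laws `p, p′` `ρ₁`-close on every measurable set; ONE Markov kernel `κ` (a step COMMON to both runs) whose ROWS are
pairwise `α`-close on every measurable set (`|κ_x(S) − κ_y(S)| ≤ α`).  Then the image laws `κ ∘ₘ p`, `κ ∘ₘ p′` are `α·ρ₁`-close on every measurable set.  Proof: the fibre
function `x ↦ κ_x(S)` is measurable with values in an interval of width `≤ α` (§0), and dag-n19-c's «sets ⇒ functions» bound integrates it against the two base laws.  SHARP (§5).
[folklore] -/
theorem abs_comp_real_sub_comp_real_le_mul_of_tv (hα : ∀ x y, ∀ S : Set Y, MeasurableSet S → |(κ x).real S - (κ y).real S| ≤ α)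
    (h₁ : ∀ S : Set X, MeasurableSet S → |p'.real S - p.real S| ≤ ρ₁) {S : Set Y} (hS : MeasurableSet S) :
    |(κ ∘ₘ p').real S - (κ ∘ₘ p).real S| ≤ α * ρ₁ := by
  obtain ⟨x₀, -⟩ : (Set.univ : Set X).Nonempty := nonempty_of_measure_ne_zero (by rw [measure_univ (μ := p)]; exact one_ne_zero)
  haveI : Nonempty X := ⟨x₀⟩
  have hρ₁ : 0 ≤ ρ₁ := radius_nonneg_of_tv h₁
  set f : X → ℝ := fun x => (κ x).real S with hf
  have hfm : Measurable f := measurable_kernelReal κ hS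
  obtain ⟨m, M, hlo, hhi, hmM, hwidth⟩ :=
    exists_bounds_of_rows (f := f) (fun x => measureReal_nonneg) (fun x => measureReal_le_one) fun x y => (abs_le.1 (hα x y S hS)).2
  rw [comp_real_eq_integral p' κ hS, comp_real_eq_integral p κ hS]
  calc |∫ x, f x ∂p' - ∫ x, f x ∂p| ≤ (M - m) * ρ₁ := abs_integral_sub_integral_le_of_tv hfm hlo hhi hmM h₁
    _ ≤ α * ρ₁ := mul_le_mul_of_nonneg_right hwidth hρ₁

/-- ★ **TWO RUNS, ONE CONTRACTING STEP PLUS A FIBRE INJECTION.**  Base laws `ρ₁`-close; run A's Markov step `κ` has rows `α`-close; run B's step `κ′` is FIBREWISE `ρ₂`-close to `κ`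
on every set.  Then `κ′ ∘ₘ p′` and `κ ∘ₘ p` are `(α·ρ₁ + ρ₂)`-close on every set (triangle through `κ ∘ₘ p′`: g4's step with base radius `0` for the injection, §1 for the
transport).  The recursion step of §4. [folklore] -/
theorem abs_comp_real_sub_comp_real_le_mul_add_of_tv (hα : ∀ x y, ∀ S : Set Y, MeasurableSet S → |(κ x).real S - (κ y).real S| ≤ α)
    (h₁ : ∀ S : Set X, MeasurableSet S → |p'.real S - p.real S| ≤ ρ₁)
    (h₂ : ∀ x, ∀ S : Set Y, MeasurableSet S → |(κ' x).real S - (κ x).real S| ≤ ρ₂) {S : Set Y} (hS : MeasurableSet S) :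
    |(κ' ∘ₘ p').real S - (κ ∘ₘ p).real S| ≤ α * ρ₁ + ρ₂ := by
  have hinj : |(κ' ∘ₘ p').real S - (κ ∘ₘ p').real S| ≤ 0 + ρ₂ :=
    abs_comp_real_sub_comp_real_le_add_of_tv (p := p') (p' := p') (κ := κ) (κ' := κ') (ρ₁ := 0)
      (fun _ _ => by rw [sub_self, abs_zero]) h₂ hS
  have htr : |(κ ∘ₘ p').real S - (κ ∘ₘ p).real S| ≤ α * ρ₁ := abs_comp_real_sub_comp_real_le_mul_of_tv hα h₁ hS
  calc |(κ' ∘ₘ p').real S - (κ ∘ₘ p).real S|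
        = |((κ' ∘ₘ p').real S - (κ ∘ₘ p').real S) + ((κ ∘ₘ p').real S - (κ ∘ₘ p).real S)| := by ring_nf
    _ ≤ |(κ' ∘ₘ p').real S - (κ ∘ₘ p').real S| + |(κ ∘ₘ p').real S - (κ ∘ₘ p).real S| := abs_add_le _ _
    _ ≤ α * ρ₁ + ρ₂ := by linarith

/-- **TWO COMMON STEPS** contract by the product of their row coefficients: `κ₂ ∘ₘ (κ₁ ∘ₘ ·)` maps `ρ₁`-close laws to `α₂·α₁·ρ₁`-close laws (§1 twice). [folklore] -/
theorem abs_comp_comp_real_sub_le_mul_mul_of_tv {κ₁ : Kernel X Y} [IsMarkovKernel κ₁] {κ₂ : Kernel Y Z} [IsMarkovKernel κ₂] {α₁ α₂ : ℝ}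
    (hα₁ : ∀ x y, ∀ S : Set Y, MeasurableSet S → |(κ₁ x).real S - (κ₁ y).real S| ≤ α₁)
    (hα₂ : ∀ x y, ∀ S : Set Z, MeasurableSet S → |(κ₂ x).real S - (κ₂ y).real S| ≤ α₂)
    (h₁ : ∀ S : Set X, MeasurableSet S → |p'.real S - p.real S| ≤ ρ₁) {S : Set Z} (hS : MeasurableSet S) :
    |(κ₂ ∘ₘ (κ₁ ∘ₘ p')).real S - (κ₂ ∘ₘ (κ₁ ∘ₘ p)).real S| ≤ α₂ * (α₁ * ρ₁) :=
  abs_comp_real_sub_comp_real_le_mul_of_tv hα₂ (fun _ hT => abs_comp_real_sub_comp_real_le_mul_of_tv hα₁ h₁ hT) hS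

end Step

/-! ## §2 Doeblin ⇒ Dobrushin at the kernel level [folklore] -/

section Doeblin

variable {X Y : Type*} [MeasurableSpace X] [MeasurableSpace Y]

/-- ★ **A DOEBLIN MINORISATION BOUNDS THE ROW COEFFICIENT.**  If every row of the Markov kernel `κ` dominates `β` times ONE probability law `ν` on every measurable set
(`β·ν(S) ≤ κ_x(S)`; necessarily `β ≤ 1`), then the rows are pairwise `(1 − β)`-close on every measurable set: `κ_x(S) = 1 − κ_x(Sᶜ) ≤ 1 − β·ν(Sᶜ) = 1 − β + β·ν(S)` and
`κ_y(S) ≥ β·ν(S)`.  (Finite-state form: `ErgodicityCoefficient.ergodicCoeff_le_one_sub_of_minorised`.) [folklore] -/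
theorem rows_le_one_sub_of_minorised (κ : Kernel X Y) [IsMarkovKernel κ] (ν : Measure Y) [IsProbabilityMeasure ν] {β : ℝ}
    (hmin : ∀ x, ∀ S : Set Y, MeasurableSet S → β * ν.real S ≤ (κ x).real S) (x y : X) {S : Set Y} (hS : MeasurableSet S) :
    |(κ x).real S - (κ y).real S| ≤ 1 - β := by
  have key : ∀ u v : X, (κ u).real S - (κ v).real S ≤ 1 - β := fun u v => by
    have hu : (κ u).real S = 1 - (κ u).real Sᶜ := by rw [probReal_compl_eq_one_sub hS]; ring
    have hν : ν.real Sᶜ = 1 - ν.real S := probReal_compl_eq_one_sub hS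
    have h1 := hmin u Sᶜ hS.compl
    have h2 := hmin v S hS
    rw [hν] at h1
    nlinarith [measureReal_nonneg (μ := ν) (s := S), measureReal_le_one (μ := ν) (s := S)]
  rw [abs_le]
  exact ⟨by linarith [key y x], key x y⟩

end Doeblin

/-! ## §3 Row coefficients multiply under kernel composition [folklore] -/

section Comp

variable {X Y Z : Type*} [MeasurableSpace X] [MeasurableSpace Y] [MeasurableSpace Z]

/-- ★★ **SUBMULTIPLICATIVITY.**  Rows of `κ₁` pairwise `α₁`-close and rows of `κ₂` pairwise `α₂`-close ⇒ rows of the composite Markov kernel `κ₂ ∘ₖ κ₁` pairwise `α₂·α₁`-close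
(`(κ₂ ∘ₖ κ₁) x = κ₂ ∘ₘ (κ₁ x)`, Mathlib `Kernel.comp_apply`, then §1 with base laws `κ₁ x`, `κ₁ y`).  LOCATED READING: a finite-range step has `α = 1` (two far-apart rows are
mutually singular), but if some `m`-fold composite of common steps enjoys a Doeblin minorisation (§2) its coefficient is `< 1` and, by this theorem, every further block of
`m` common steps contracts by it — the TV currency's answer to g6's caveat «single steps have finite range (infinite projective diameter)».  (Finite-state form:
`ErgodicityCoefficientProducts.ergodicCoeff_mul_le`.) [folklore] -/
theorem rows_comp_le_mul (κ₁ : Kernel X Y) [IsMarkovKernel κ₁] (κ₂ : Kernel Y Z) [IsMarkovKernel κ₂] {α₁ α₂ : ℝ}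
    (hα₁ : ∀ x y, ∀ S : Set Y, MeasurableSet S → |(κ₁ x).real S - (κ₁ y).real S| ≤ α₁)
    (hα₂ : ∀ x y, ∀ S : Set Z, MeasurableSet S → |(κ₂ x).real S - (κ₂ y).real S| ≤ α₂) (x y : X) {S : Set Z} (hS : MeasurableSet S) :
    |((κ₂ ∘ₖ κ₁) x).real S - ((κ₂ ∘ₖ κ₁) y).real S| ≤ α₂ * α₁ := by
  rw [Kernel.comp_apply, Kernel.comp_apply]
  exact abs_comp_real_sub_comp_real_le_mul_of_tv (p := κ₁ y) (p' := κ₁ x) hα₂ (fun S hS => hα₁ x y S hS) hS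

/-- The composite of Markov kernels is Markov (Mathlib instance, recorded for the chain bookkeeping of consumers). [folklore] -/
theorem isMarkovKernel_comp (κ₁ : Kernel X Y) [IsMarkovKernel κ₁] (κ₂ : Kernel Y Z) [IsMarkovKernel κ₂] : IsMarkovKernel (κ₂ ∘ₖ κ₁) := by
  infer_instance

end Comp

/-! ## §4 Chains: the radius after `n` steps is node U4's transported total [folklore] -/

section Chain

variable {Ω : ℕ → Type*} [∀ k, MeasurableSpace (Ω k)]
  {μ μ' : ∀ k, Measure (Ω k)} [∀ k, IsProbabilityMeasure (μ k)] [∀ k, IsProbabilityMeasure (μ' k)]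
  {κ κ' : ∀ k, Kernel (Ω k) (Ω (k + 1))} [∀ k, IsMarkovKernel (κ k)] [∀ k, IsMarkovKernel (κ' k)]
  {a : ℝ} {s : ℕ → ℝ}

/-- ★★ **THE CHAIN RADIUS IS THE CONVOLUTION OF THE INJECTIONS WITH THE CONTRACTION.**  Two runs' laws `μ_k`, `μ′_k` on spaces `Ω k` driven by Markov steps
`μ_{k+1} = κ_k ∘ₘ μ_k`, `μ′_{k+1} = κ′_k ∘ₘ μ′_k` (recursion as HYPOTHESES); run A's steps `κ_k` have rows pairwise `a`-close; run B's steps are fibrewise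
`s (k+1)`-close to run A's on every set (the discrepancy INJECTED at step `k`); the birth laws are `s 0`-close.  Then at step `n` the laws are
`(Σ_{(j,m) ∈ antidiagonal n} s_j · a^m)`-close on every set: an injection at step `j − 1` (birth: `j = 0`) is contracted once by each of the `m = n − j` later common steps.
Induction on §1's `abs_comp_real_sub_comp_real_le_mul_add_of_tv`; the index bookkeeping is Mathlib's `Finset.Nat.antidiagonal_succ'`. [folklore] -/
theorem abs_chain_real_sub_le_antidiagonal (hμ : ∀ k, μ (k + 1) = κ k ∘ₘ μ k) (hμ' : ∀ k, μ' (k + 1) = κ' k ∘ₘ μ' k)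
    (h0 : ∀ S : Set (Ω 0), MeasurableSet S → |(μ' 0).real S - (μ 0).real S| ≤ s 0)
    (hα : ∀ k, ∀ x y, ∀ S : Set (Ω (k + 1)), MeasurableSet S → |(κ k x).real S - (κ k y).real S| ≤ a)
    (hσ : ∀ k x, ∀ S : Set (Ω (k + 1)), MeasurableSet S → |(κ' k x).real S - (κ k x).real S| ≤ s (k + 1)) :
    ∀ (n : ℕ) (S : Set (Ω n)), MeasurableSet S →
      |(μ' n).real S - (μ n).real S| ≤ ∑ q ∈ antidiagonal n, s q.1 * a ^ q.2 := by
  intro n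
  induction n with
  | zero => intro S hS; simpa using h0 S hS
  | succ n ih =>
    intro S hS
    have key := abs_comp_real_sub_comp_real_le_mul_add_of_tv (p := μ n) (p' := μ' n) (κ := κ n) (κ' := κ' n)
      (ρ₁ := ∑ q ∈ antidiagonal n, s q.1 * a ^ q.2) (hα n) ih (hσ n) hS
    rw [hμ n, hμ' n]
    refine key.trans (le_of_eq ?_)
    rw [Nat.antidiagonal_succ', sum_cons, sum_map]
    simp only [Function.Embedding.coe_prodMap, Function.Embedding.coe_refl, Function.Embedding.coeFn_mk, Prod.map_fst, Prod.map_snd,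
      id_eq, pow_zero, mul_one, pow_succ]
    rw [mul_sum]
    have : ∀ q ∈ antidiagonal n, a * (s q.1 * a ^ q.2) = s q.1 * (a ^ q.2 * a) := fun q _ => by ring
    rw [sum_congr rfl this]
    ring

/-- ★ **… = NODE U4's TRANSPORTED TOTAL** `T4CauchySum.delta 1 a (fun _ ↦ s) n` (`delta E ρ inj K = E·Σ_{(j,m) ∈ antidiagonal K} inj K j·ρ^m`): in the TV currency the
contraction `ρ := a` of node U4 is the common steps' ROW COEFFICIENT and the injected rate `inj K j := s j` is the fibre discrepancy of step `j − 1` (birth at `j = 0`) — the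
shape `T4CauchySum` postulates, PRODUCED by §1. [folklore] -/
theorem abs_chain_real_sub_le_delta (hμ : ∀ k, μ (k + 1) = κ k ∘ₘ μ k) (hμ' : ∀ k, μ' (k + 1) = κ' k ∘ₘ μ' k)
    (h0 : ∀ S : Set (Ω 0), MeasurableSet S → |(μ' 0).real S - (μ 0).real S| ≤ s 0)
    (hα : ∀ k, ∀ x y, ∀ S : Set (Ω (k + 1)), MeasurableSet S → |(κ k x).real S - (κ k y).real S| ≤ a)
    (hσ : ∀ k x, ∀ S : Set (Ω (k + 1)), MeasurableSet S → |(κ' k x).real S - (κ k x).real S| ≤ s (k + 1))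
    (n : ℕ) {S : Set (Ω n)} (hS : MeasurableSet S) :
    |(μ' n).real S - (μ n).real S| ≤ delta 1 a (fun _ => s) n := by
  unfold delta
  rw [one_mul]
  exact abs_chain_real_sub_le_antidiagonal hμ hμ' h0 hα hσ n S hS

/-- ★ **EXACTLY COMMON STEPS FORGET THE BIRTH DISCREPANCY GEOMETRICALLY**: `κ′ = κ` (no injections) ⇒ at step `n` the laws are `(s₀·aⁿ)`-close — contrast g4's
`abs_chain_real_sub_le_initial` (`≤ s₀`, row coefficient capped at `1`). [folklore] -/
theorem abs_chain_real_sub_le_mul_pow_of_common {ρ₀ : ℝ} (hμ : ∀ k, μ (k + 1) = κ k ∘ₘ μ k) (hμ' : ∀ k, μ' (k + 1) = κ k ∘ₘ μ' k)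
    (h0 : ∀ S : Set (Ω 0), MeasurableSet S → |(μ' 0).real S - (μ 0).real S| ≤ ρ₀)
    (hα : ∀ k, ∀ x y, ∀ S : Set (Ω (k + 1)), MeasurableSet S → |(κ k x).real S - (κ k y).real S| ≤ a)
    (n : ℕ) {S : Set (Ω n)} (hS : MeasurableSet S) :
    |(μ' n).real S - (μ n).real S| ≤ ρ₀ * a ^ n := by
  set s : ℕ → ℝ := fun j => if j = 0 then ρ₀ else 0 with hs
  have h := abs_chain_real_sub_le_antidiagonal (κ := κ) (κ' := κ) (s := s) hμ hμ' (by simpa [hs] using h0) hα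
    (fun k x S _ => by simp [hs]) n S hS
  refine h.trans (le_of_eq ?_)
  rw [Finset.sum_eq_single_of_mem ((0, n) : ℕ × ℕ) (by simp [Finset.HasAntidiagonal.mem_antidiagonal]) fun q hq hq0 => ?_]
  · simp [hs]
  · have hq1 : q.1 ≠ 0 := fun h1 => hq0 (by
      have := Finset.HasAntidiagonal.mem_antidiagonal.mp hq
      ext <;> simp_all)
    simp [hs, hq1]

end Chain

/-! ## §5 Sharpness of §1 [folklore] -/

section Sharpness

/-- ★ **§1's CONSTANT IS OPTIMAL.**  On `Bool`: base laws `p = δ_false`, `p′ = (1 − ρ₁)δ_false + ρ₁δ_true` (`ρ₁`-close); ONE Markov kernel `κ`, common to both runs, with rows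
`κ_false = δ_false`, `κ_true = (1 − α)δ_false + αδ_true` (rows `α`-close; `α, ρ₁ ∈ [0, 1]`).  Then `κ ∘ₘ p = δ_false` and the image gap at `{true}` EQUALS `α·ρ₁`.  So no constant
below `α·ρ₁` is a theorem for a common Markov step with row coefficient `α`. [folklore] -/
theorem tv_commonStep_sharp_toy {α ρ₁ : ℝ} (hα : 0 ≤ α) (hα1 : α ≤ 1) (hρ₁ : 0 ≤ ρ₁) (hρ₁1 : ρ₁ ≤ 1) :
    let p : Measure Bool := Measure.dirac false
    let p' : Measure Bool := ENNReal.ofReal (1 - ρ₁) • Measure.dirac false + ENNReal.ofReal ρ₁ • Measure.dirac true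
    let να : Measure Bool := ENNReal.ofReal (1 - α) • Measure.dirac false + ENNReal.ofReal α • Measure.dirac true
    let κ : Kernel Bool Bool := ⟨fun x => cond x να (Measure.dirac false), measurable_of_countable _⟩
    IsMarkovKernel κ ∧ (∀ x y, ∀ S : Set Bool, |(κ x).real S - (κ y).real S| ≤ α) ∧
      (κ ∘ₘ p').real {true} - (κ ∘ₘ p).real {true} = α * ρ₁ := by
  intro p p' να κ
  obtain ⟨hP₁, hT₁, hf₁⟩ := twoPoint_toy hρ₁ hρ₁1
  obtain ⟨hPα, hTα, hfα⟩ := twoPoint_toy hα hα1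
  haveI := hP₁; haveI := hPα
  have hκ : ∀ x, κ x = cond x να (Measure.dirac false) := fun _ => rfl
  have hMκ : IsMarkovKernel κ := ⟨fun x => by cases x <;> rw [hκ] <;> simp only [cond_true, cond_false] <;> infer_instance⟩
  haveI := hMκ
  refine ⟨hMκ, fun x y S => ?_, ?_⟩
  · cases x <;> cases y
    · rw [sub_self, abs_zero]; exact hα
    · rw [hκ, hκ, cond_false, cond_true, abs_sub_comm]; exact hTα S
    · rw [hκ, hκ, cond_true, cond_false]; exact hTα S
    · rw [sub_self, abs_zero]; exact hα
  · rw [comp_real_eq_integral p' κ (measurableSet_singleton _), comp_real_eq_integral p κ (measurableSet_singleton _),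
      integral_fintype Integrable.of_finite, integral_fintype Integrable.of_finite, Fintype.sum_bool, Fintype.sum_bool]
    simp only [hκ, cond_true, cond_false, smul_eq_mul]
    have hναt : να {true} = ENNReal.ofReal α := by
      show (ENNReal.ofReal (1 - α) • (Measure.dirac false : Measure Bool) + ENNReal.ofReal α • Measure.dirac true) {true} = _
      simp
    have hp't : p' {true} = ENNReal.ofReal ρ₁ := by
      show (ENNReal.ofReal (1 - ρ₁) • (Measure.dirac false : Measure Bool) + ENNReal.ofReal ρ₁ • Measure.dirac true) {true} = _
      simp
    have hp'f : p' {false} = ENNReal.ofReal (1 - ρ₁) := hf₁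
    have hpt : p {true} = 0 := by show (Measure.dirac false : Measure Bool) {true} = 0; simp
    have hpf : p {false} = 1 := by show (Measure.dirac false : Measure Bool) {false} = 1; simp
    simp only [measureReal_def]
    rw [hναt, hp't, hp'f, hpt, hpf]
    simp only [ENNReal.toReal_ofReal hα, ENNReal.toReal_ofReal hρ₁, ENNReal.toReal_ofReal (sub_nonneg.2 hρ₁1), ENNReal.toReal_zero,
      ENNReal.toReal_one]
    ring

end Sharpness

/-! ## §6 The N19′ shape from MASS_cl and a TV_cl radius dominated by a transported total [folklore] -/

section Edge

open Summit.QuantumFields.BalabanUV.T4Continuum.NE1p.DressedMGFForm (MGFForm)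
open Summit.QuantumFields.BalabanUV.T4Continuum.Spine.NE7 (Core)
open Summit.QuantumFields.YangMills.BalabanUVNodes.N19CoreTVInvariant (core_of_mass_of_tv)

variable {ι : Type*} [DecidableEq ι] {Ω : ℕ → Type*} [∀ K, MeasurableSpace (Ω K)]
variable {l₀ vol B : ℝ} {T : ℕ → Finset ι} {Bad : ℕ → ℝ → Finset ι} {W : ∀ K, Ω K → ℝ}
  {μA μB : ∀ K, ι → Measure (Ω K)} {P Q : ℕ → ℝ → ι → ℝ} {r₁ ρ : ℕ → ℝ}

/-- ★★ **THE N19′ SHAPE FROM MASS_cl AND A CONTRACTED TV_cl RADIUS.**  dag-n19-c's `core_of_mass_of_tv` BY NAME: two runs' dressed class terms in MGF form on common class spaces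
(one observable family `W_K`, `|W| ≤ B`), the MASS letter with radius `r₁ K`, the TV letter (normalised class laws `ρ K`-close on every set on the good classes), and NOW: the TV
radius dominated by node U4's transported total, `ρ K ≤ T4CauchySum.delta E a inj K`, under an injected rate `InjectedRate C c θ inj` with `θ ∈ [0,1[` and a contraction
`a ∈ [0,1[` (by §4: `a` = the row coefficient of the steps common to both runs, `inj K` = birth radius and fibre injections of run pair `K`), `0 ≤ E`, `0 ≤ l₀`, `0 < vol`,
and a summable MASS radius.  CONCLUSION: `∃ δ, Spine.NE7.Core l₀ vol T Bad P Q δ ∧ Summable δ` — with `δ K := (r₁ K + (e^{2 l₀ B} − 1)·delta E a inj K) ∕ vol`, summable by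
`T4CauchySum.summable_delta`.  The TV twin of g6-S's `coreEdge_of_totals_of_commonSteps`, with NO projective-diameter hypothesis. [folklore] -/
theorem coreEdge_of_mass_of_tv_delta (hP : MGFForm B T W μA P) (hQ : MGFForm B T W μB Q)
    (hM : ∀ K : ℕ, ∃ c : ℝ, ∀ t : ℝ, |t| ≤ l₀ → ∀ τ ∈ T K \ Bad K t,
      ENNReal.ofReal (Real.exp (c - r₁ K)) * μA K τ Set.univ ≤ μB K τ Set.univ ∧
        μB K τ Set.univ ≤ ENNReal.ofReal (Real.exp (c + r₁ K)) * μA K τ Set.univ)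
    (hTV : ∀ (K : ℕ) (t : ℝ), |t| ≤ l₀ → ∀ τ ∈ T K \ Bad K t, ∀ S : Set (Ω K), MeasurableSet S →
      |(μB K τ).real S / (μB K τ).real Set.univ - (μA K τ).real S / (μA K τ).real Set.univ| ≤ ρ K)
    {C θ E a : ℝ} {c : ℕ} {inj : ℕ → ℕ → ℝ} (hinj : InjectedRate C c θ inj) (hE : 0 ≤ E) (hθ : 0 ≤ θ) (hθ1 : θ < 1)
    (ha : 0 ≤ a) (ha1 : a < 1) (hρ : ∀ K, ρ K ≤ delta E a inj K) (hl₀ : 0 ≤ l₀) (hvol : 0 < vol) (hr₁ : Summable r₁) :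
    ∃ δ : ℕ → ℝ, Core l₀ vol T Bad P Q δ ∧ Summable δ := by
  set L : ℝ := Real.exp (2 * (l₀ * B)) - 1 with hL
  have hB : 0 ≤ B := hP.nonneg
  have hL0 : 0 ≤ L := by
    rw [hL, sub_nonneg]
    exact Real.one_le_exp (by positivity)
  refine ⟨fun K => (r₁ K + L * delta E a inj K) / vol, ?_, ?_⟩
  · refine core_of_mass_of_tv hP hQ hM hTV fun K => ?_
    have hK : r₁ K + L * ρ K ≤ r₁ K + L * delta E a inj K := by
      have := mul_le_mul_of_nonneg_left (hρ K) hL0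
      linarith
    calc r₁ K + (Real.exp (2 * (l₀ * B)) - 1) * ρ K = r₁ K + L * ρ K := by rw [hL]
      _ ≤ r₁ K + L * delta E a inj K := hK
      _ = vol * ((r₁ K + L * delta E a inj K) / vol) := by field_simp
  · exact (hr₁.add ((summable_delta hinj hE hθ hθ1 ha ha1).mul_left L)).div_const vol

end Edge

end Summit.QuantumFields.YangMills.BalabanUVNodes.N19TVCommonStepContraction

end
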